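import Mathlib
import Summits.NavierStokesRegularity.NavierStokesRegularity.Theorems.EulerZoomLiouvillePowerGaugeEulerLiouvilleBallMeanValue
import Summits.NavierStokesRegularity.NavierStokesRegularity.Theorems.EulerZoomLiouvillePowerGaugeEulerLiouvilleSphereMeanValue
import Summits.NavierStokesRegularity.NavierStokesRegularity.Theorems.EulerZoomLiouvillePowerGaugeEulerLiouvilleRadialVirial
import HarnessLib

/-!
# R49 plate t52-MV (final): `MeanValueFormula γ` and `SphereMeanValueFormula γ` for `γ`-profiles about every centre
# (nsreg-p2 ROUND-49 «EVERY BALL BREATHES», texts VERBATIM from `r49/Sketch49.lean` l.84–91 and l.143–150; seat ns-sfl-p1 g8,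
# `--supports stmt-NavierStokesRegularity-19832 --as helper`)

* `ClassicalProfile.meanValueFormula (γ)` : `NsregP2.R49.MeanValueFormula γ` VERBATIM — Chae–Wolf 2016 Lemma 2.1 (2.1) in tent
  form, `∫_{B_δ(x₀)} (⟪V,z⟫²/‖z‖ + ‖z‖·P) = ∫_{B_δ(x₀)} (δ − ‖z‖)(‖V‖² + 3P)`, for every `γ`-profile `(V, P)` (any similarity centre
  `c`), every centre `x₀` and radius `δ > 0`: ns-ezl-w2 g5's `radialVirialIdentity` (t52-RV) fed into
  `meanValueFormula_of_radialVirial` (`…BallMeanValue`, the tent-weight dominated-convergence passage).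
* `ClassicalProfile.sphereMeanValueFormula (γ)` : `NsregP2.R49.SphereMeanValueFormula γ` VERBATIM — the printed shape
  `δ³ · sphereIntegral volume (z ↦ ⟪V(z + x₀), z⟫²/‖z‖² + P(z + x₀)) δ = ∫_{B_δ(x₀)} (‖V‖² + 3P)`
  (`sphereMeanValueFormula_of_meanValue`, `…SphereMeanValue`).

HONEST FRAMING: instrument identities of ROUND-49 (class-free, about hypothetical profiles); nothing about the crux E (19832 OPEN)
or NS regularity is proved here. [cite: ChaeWolf2016, Lemma 2.1 (2.1)] [nsreg-p2 R49 §2.3, §2.7]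
-/

noncomputable section

set_option linter.dupNamespace false

open MeasureTheory Set Filter Topology Metric Function
open scoped RealInnerProductSpace Topology

namespace Summit.NavierStokesRegularity.NavierStokesRegularity.Theorems.PowerGaugeEulerLiouville

open Literature.Analysis Literature.Analysis.FluidPDE

namespace ClassicalProfile

/-- **MEAN-VALUE FORMULA** (`NsregP2.R49.MeanValueFormula γ`, text VERBATIM): Chae–Wolf (2.1) in tent form for `γ`-profiles
about every centre. [cite: ChaeWolf2016, Lemma 2.1 (2.1)] -/
theorem meanValueFormula (γ : ℝ) :
    ∀ (c : EuclideanSpace ℝ (Fin 3)) (V : EuclideanSpace ℝ (Fin 3) → EuclideanSpace ℝ (Fin 3)) (P : EuclideanSpace ℝ (Fin 3) → ℝ),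
      IsSelfSimilarEulerProfile γ c V P →
      ∀ (x₀ : EuclideanSpace ℝ (Fin 3)) (δ : ℝ), 0 < δ →
        ∫ y in ball x₀ δ, (⟪V y, y - x₀⟫ ^ 2 / ‖y - x₀‖ + ‖y - x₀‖ * P y)
          = ∫ y in ball x₀ δ, (δ - ‖y - x₀‖) * (‖V y‖ ^ 2 + 3 * P y) := by
  intro c V P hprof x₀ δ hδ
  exact meanValueFormula_of_radialVirial hprof.contDiff_velocity.continuous hprof.contDiff_pressure.continuous x₀
    (fun ψ hψ hψc => radialVirialIdentity γ c V P hprof x₀ ψ hψ hψc) hδ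

/-- **SPHERE MEAN-VALUE FORMULA** (`NsregP2.R49.SphereMeanValueFormula γ`, text VERBATIM): the printed shape
`δ ∮_{∂B_δ(x₀)} (V_n² + P) dS = ∫_{B_δ(x₀)} (‖V‖² + 3P)` with the tree's `sphereIntegral`. [cite: ChaeWolf2016, Lemma 2.1 (2.1)] -/
theorem sphereMeanValueFormula (γ : ℝ) :
    ∀ (c : EuclideanSpace ℝ (Fin 3)) (V : EuclideanSpace ℝ (Fin 3) → EuclideanSpace ℝ (Fin 3)) (P : EuclideanSpace ℝ (Fin 3) → ℝ),
      IsSelfSimilarEulerProfile γ c V P →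
      ∀ (x₀ : EuclideanSpace ℝ (Fin 3)) (δ : ℝ), 0 < δ →
        δ ^ 3 * sphereIntegral volume
            (fun z : EuclideanSpace ℝ (Fin 3) => ⟪V (z + x₀), z⟫ ^ 2 / ‖z‖ ^ 2 + P (z + x₀)) δ
          = ∫ y in ball x₀ δ, (‖V y‖ ^ 2 + 3 * P y) := by
  intro c V P hprof x₀ δ hδ
  exact sphereMeanValueFormula_of_meanValue hprof.contDiff_velocity.continuous hprof.contDiff_pressure.continuous x₀
    (fun ρ hρ => meanValueFormula γ c V P hprof x₀ ρ hρ) hδ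

end ClassicalProfile

end Summit.NavierStokesRegularity.NavierStokesRegularity.Theorems.PowerGaugeEulerLiouville

end
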